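import Literature.Probability.LatticeModels.LatticeSineGordon
import Summits.QuantumFields.YangMills.Theorems.SmallCircleAnchorAnchorGapStubDebyeScreening11

/-!
# Crux `AnchorGap` (stmt-QuantumFields-11141), line `registered` — Debye–Hückel splitting of the weight (set-up of step M-b under stub DSred)

The Mayer/Duhamel set-up of the expansion behind stub DSred (`stub_debyeScreening`; remaining
core `stub_debyeScreening_of_flat`): the Boltzmann weight of the lattice sine-Gordon gas
(`Literature.Probability.LatticeModels.LatticeSineGordon`) is EXACTLY the Debye–Hückel Gaussian
weight of `…StubDebyeScreening11` (precision `P = g⁻²[(−Δ_N + ε) ⊗ 1 + 1 ⊗ 2ζg²Σ_r α_rα_rᵀ]`) times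
the vacuum-energy constant `e^{2ζVM}` times a positive local remainder factor,

  `weight = e^{2ζVM} · e^{−½ φᵀPφ} · Π_x exp(2ζ Σ_r [cos(α_r·φ_x) − 1 + (α_r·φ_x)²/2])`,

with `0 ≤ cos u − 1 + u²/2 ≤ u⁴/24`:

* `cos_sub_quadratic_nonneg`, `cos_sub_quadratic_le` — the cosine remainder bounds (the quartic
  bound by integrating `cos ≥ 1 − u²/2` twice, `monotoneOn_of_deriv_nonneg`);
* `tilt_le` — stability `tilt ≤ 2ζVM` (`ζ ≥ 0`);
* `tilt_eq_dh_split` — `tilt = 2ζVM − ζ Σ_x Σ_r (α_r·φ_x)² + 2ζ Σ_x Σ_r [cos − 1 + u²/2](α_r·φ_x)`;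
* `weight_eq_dhGaussian_mul_remainder` — the displayed identity (`g ≠ 0`; `dhMatrix_form`);
* `dh_remainder_bounds` — `0 ≤ 2ζ Σ_x Σ_r [cos − 1 + u²/2] ≤ (ζ/12) Σ_x Σ_r (α_r·φ_x)⁴` (`ζ ≥ 0`):
  the remainder vertex is a factor `≥ 1`, quartically small in the small-field region — the
  honest input of the small-field part of the expansion; large fields need the Peierls/sector
  expansion of Brydges 1978 §3 (stability there comes from `tilt_le`, not from the quadratic form).
-/

set_option autoImplicit false

noncomputable section

namespace Summit.QuantumFields.YangMills.Theorems.AnchorGap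

open MeasureTheory Finset Matrix
open Literature.Probability.LatticeModels

/-- **The cosine remainder is non-negative**: `0 ≤ cos u − 1 + u²/2`. [folklore] -/
theorem cos_sub_quadratic_nonneg :
    ∀ u : ℝ, 0 ≤ Real.cos u - 1 + u ^ 2 / 2 := by
  intro u
  linarith [Real.one_sub_sq_div_two_le_cos (x := u)]

/-- **Quartic bound on the cosine remainder**: `cos u − 1 + u²/2 ≤ u⁴/24` (twice integrated
`cos ≥ 1 − u²/2`). [folklore] -/
theorem cos_sub_quadratic_le :
    ∀ u : ℝ, Real.cos u - 1 + u ^ 2 / 2 ≤ u ^ 4 / 24 := by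
  -- `g(t) = sin t − t + t³/6 ≥ 0` on `t ≥ 0`
  have hg : ∀ t : ℝ, 0 ≤ t → 0 ≤ Real.sin t - t + t ^ 3 / 6 := by
    intro t ht
    have hmono : MonotoneOn (fun t : ℝ => Real.sin t - t + t ^ 3 / 6) (Set.Ici 0) := by
      refine monotoneOn_of_deriv_nonneg (convex_Ici 0)
        (by fun_prop : Continuous fun t : ℝ => Real.sin t - t + t ^ 3 / 6).continuousOn
        (by fun_prop : Differentiable ℝ fun t : ℝ => Real.sin t - t + t ^ 3 / 6).differentiableOn ?_
      intro x _
      have h := ((Real.hasDerivAt_sin x).sub (hasDerivAt_id x)).add ((hasDerivAt_pow 3 x).div_const 6)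
      have hfun : (fun t : ℝ => Real.sin t - t + t ^ 3 / 6) = (Real.sin - id + fun x => x ^ 3 / 6) := by
        funext t; simp
      have hd : deriv (fun t : ℝ => Real.sin t - t + t ^ 3 / 6) x = Real.cos x - 1 + x ^ 2 / 2 := by
        rw [hfun, h.deriv]
        push_cast
        ring
      rw [hd]
      exact cos_sub_quadratic_nonneg x
    have := hmono (Set.mem_Ici.2 le_rfl) (Set.mem_Ici.2 ht) ht
    simpa using this
  -- `h(u) = u⁴/24 − (cos u − 1 + u²/2) ≥ 0` on `u ≥ 0`
  have hh : ∀ u : ℝ, 0 ≤ u → Real.cos u - 1 + u ^ 2 / 2 ≤ u ^ 4 / 24 := by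
    intro u hu
    have hmono : MonotoneOn (fun u : ℝ => u ^ 4 / 24 - (Real.cos u - 1 + u ^ 2 / 2)) (Set.Ici 0) := by
      refine monotoneOn_of_deriv_nonneg (convex_Ici 0)
        (by fun_prop : Continuous fun u : ℝ => u ^ 4 / 24 - (Real.cos u - 1 + u ^ 2 / 2)).continuousOn
        (by fun_prop : Differentiable ℝ fun u : ℝ => u ^ 4 / 24 - (Real.cos u - 1 + u ^ 2 / 2)).differentiableOn ?_
      intro x hx
      rw [interior_Ici] at hx
      have h := ((hasDerivAt_pow 4 x).div_const 24).sub
        ((((Real.hasDerivAt_cos x).sub (hasDerivAt_const x (1 : ℝ))).add ((hasDerivAt_pow 2 x).div_const 2)))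
      have hfun : (fun u : ℝ => u ^ 4 / 24 - (Real.cos u - 1 + u ^ 2 / 2)) =
          ((fun x : ℝ => x ^ 4 / 24) - ((Real.cos - fun _ : ℝ => (1 : ℝ)) + fun x : ℝ => x ^ 2 / 2)) := by
        funext t; simp
      have hd : deriv (fun u : ℝ => u ^ 4 / 24 - (Real.cos u - 1 + u ^ 2 / 2)) x =
          Real.sin x - x + x ^ 3 / 6 := by
        rw [hfun, h.deriv]
        push_cast
        ring
      rw [hd]
      exact hg x (le_of_lt hx)
    have := hmono (Set.mem_Ici.2 le_rfl) (Set.mem_Ici.2 hu) hu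
    simp only [Real.cos_zero] at this
    linarith
  intro u
  rcases le_total 0 u with hu | hu
  · exact hh u hu
  · have := hh (-u) (by linarith)
    have e2 : (-u) ^ 2 = u ^ 2 := by ring
    have e4 : (-u) ^ 4 = u ^ 4 := by ring
    rwa [Real.cos_neg, e2, e4] at this

/-- **Stability of the sine-Gordon tilt**: `tilt ≤ 2ζ · #sites · #charges` for `ζ ≥ 0`
(`cos ≤ 1`). [folklore] -/
theorem tilt_le :
    ∀ (d N k : ℕ) [NeZero N] (ι : Type) [Fintype ι] (α : ι → Fin k → ℝ) (ζ : ℝ), 0 ≤ ζ → ∀ φ : LatticeSineGordon.Config d N k, LatticeSineGordon.tilt α ζ φ ≤ 2 * ζ * (Fintype.card (TorusSite d N) * Fintype.card ι) := by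
  intro d N k _ ι _ α ζ hζ φ
  have h := LatticeSineGordon.abs_tilt_le (d := d) (N := N) α ζ φ
  rw [abs_of_nonneg hζ] at h
  exact (le_abs_self _).trans h

/-- **Debye–Hückel splitting of the tilt.** Exactly,
`tilt(φ) = 2ζ V M − ζ Σ_x Σ_r (α_r·φ_x)² + 2ζ Σ_x Σ_r [cos(α_r·φ_x) − 1 + (α_r·φ_x)²/2]`:
constant (vacuum energy) − Debye mass term + non-negative quartic-small remainder. [folklore] -/
theorem tilt_eq_dh_split :
    ∀ (d N k : ℕ) [NeZero N] (ι : Type) [Fintype ι] (α : ι → Fin k → ℝ) (ζ : ℝ) (φ : LatticeSineGordon.Config d N k), LatticeSineGordon.tilt α ζ φ = 2 * ζ * (Fintype.card (TorusSite d N) * Fintype.card ι) - ζ * ∑ x : TorusSite d N, ∑ r : ι, (LatticeSineGordon.pairing (α r) φ x) ^ 2 + 2 * ζ * ∑ x : TorusSite d N, ∑ r : ι, (Real.cos (LatticeSineGordon.pairing (α r) φ x) - 1 + (LatticeSineGordon.pairing (α r) φ x) ^ 2 / 2) := by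
  intro d N k _ ι _ α ζ φ
  unfold LatticeSineGordon.tilt
  have hconst : (Fintype.card (TorusSite d N) * Fintype.card ι : ℝ) = ∑ _x : TorusSite d N, ∑ _r : ι, (1 : ℝ) := by
    simp [sum_const, Finset.card_univ]
  have hmul : ∀ (c : ℝ) (f : TorusSite d N → ι → ℝ), c * ∑ x, ∑ r, f x r = ∑ x, ∑ r, c * f x r :=
    fun c f => by rw [mul_sum]; exact sum_congr rfl fun _ _ => mul_sum _ _ _
  rw [hconst, hmul, hmul, hmul, hmul, ← sum_sub_distrib, ← sum_add_distrib]
  refine sum_congr rfl fun x _ => ?_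
  rw [← sum_sub_distrib, ← sum_add_distrib]
  refine sum_congr rfl fun r _ => ?_
  ring

/-- Rank-one algebra: `Σ_{a,a'} v_a (t Σ_r c_{ra} c_{ra'}) v_{a'} = t Σ_r (Σ_a c_{ra} v_a)²`. -/
private lemma quadForm_rankSum {k : ℕ} {ι : Type} [Fintype ι] (c : ι → Fin k → ℝ) (v : Fin k → ℝ) (t : ℝ) :
    ∑ a : Fin k, ∑ a' : Fin k, v a * (t * ∑ r : ι, c r a * c r a') * v a' =
      t * ∑ r : ι, (∑ a : Fin k, c r a * v a) ^ 2 := by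
  have h1 : ∀ a a' : Fin k, v a * (t * ∑ r : ι, c r a * c r a') * v a' =
      ∑ r : ι, t * (c r a * v a * (c r a' * v a')) := by
    intro a a'
    rw [Finset.mul_sum, Finset.mul_sum, Finset.sum_mul]
    exact sum_congr rfl fun r _ => by ring
  simp_rw [h1]
  calc ∑ a : Fin k, ∑ a' : Fin k, ∑ r : ι, t * (c r a * v a * (c r a' * v a'))
      = ∑ a : Fin k, ∑ r : ι, ∑ a' : Fin k, t * (c r a * v a * (c r a' * v a')) :=
        sum_congr rfl fun a _ => Finset.sum_comm
    _ = ∑ r : ι, ∑ a : Fin k, ∑ a' : Fin k, t * (c r a * v a * (c r a' * v a')) := Finset.sum_comm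
    _ = t * ∑ r : ι, (∑ a : Fin k, c r a * v a) ^ 2 := by
        rw [Finset.mul_sum]
        refine sum_congr rfl fun r _ => ?_
        rw [sq, Finset.sum_mul_sum, Finset.mul_sum]
        refine sum_congr rfl fun a _ => ?_
        rw [Finset.mul_sum]

/-- **The Boltzmann weight as Debye–Hückel Gaussian times a positive remainder** (Mayer/Duhamel
set-up of the expansion): with the precision matrix `P = g⁻²[(−Δ_N + ε) ⊗ 1 + 1 ⊗ B]`,
`B = 2ζg² Σ_r α_r α_rᵀ` (`dhMatrix_form`),
`weight = e^{2ζVM} · e^{−½ φᵀPφ} · exp(2ζ Σ_x Σ_r [cos(α_r·φ_x) − 1 + (α_r·φ_x)²/2])`. [folklore] -/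
theorem weight_eq_dhGaussian_mul_remainder :
    ∀ (d N k : ℕ) [NeZero N] (ι : Type) [Fintype ι] (α : ι → Fin k → ℝ) (g ε ζ : ℝ), g ≠ 0 → ∀ (φ : LatticeSineGordon.Config d N k), LatticeSineGordon.weight α g ε ζ φ = Real.exp (2 * ζ * (Fintype.card (TorusSite d N) * Fintype.card ι)) * Real.exp (-(φ ⬝ᵥ (Matrix.of (fun p q : TorusSite d N × Fin k => (g ^ 2)⁻¹ * ((if p.1 = q.1 then (if p.2 = q.2 then ε + 2 * (d : ℝ) else 0) + (2 * ζ * g ^ 2 * ∑ r : ι, α r p.2 * α r q.2) else 0) - (if p.2 = q.2 then ∑ i : Fin d, ((if q.1 = p.1 + Pi.single i 1 then (1 : ℝ) else 0) + (if q.1 = p.1 - Pi.single i 1 then (1 : ℝ) else 0)) else 0))) *ᵥ φ)) / 2) * Real.exp (2 * ζ * ∑ x : TorusSite d N, ∑ r : ι, (Real.cos (LatticeSineGordon.pairing (α r) φ x) - 1 + (LatticeSineGordon.pairing (α r) φ x) ^ 2 / 2)) := by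
  intro d N k _ ι _ α g ε ζ hg φ
  rw [LatticeSineGordon.weight, ← Real.exp_add, ← Real.exp_add]
  congr 1
  rw [tilt_eq_dh_split d N k ι α ζ φ,
    dhMatrix_form d N k g ε (fun a a' : Fin k => 2 * ζ * g ^ 2 * ∑ r : ι, α r a * α r a') φ]
  -- the mass term: `Σ_x φ_xᵀ B φ_x = g² · 2ζ Σ_x Σ_r (α_r·φ_x)²`
  have hmass : ∑ x : TorusSite d N, ∑ a : Fin k, ∑ a' : Fin k,
      φ (x, a) * (2 * ζ * g ^ 2 * ∑ r : ι, α r a * α r a') * φ (x, a') =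
      g ^ 2 * (2 * ζ * ∑ x : TorusSite d N, ∑ r : ι, (LatticeSineGordon.pairing (α r) φ x) ^ 2) := by
    have hx : ∀ x : TorusSite d N, ∑ a : Fin k, ∑ a' : Fin k,
        φ (x, a) * (2 * ζ * g ^ 2 * ∑ r : ι, α r a * α r a') * φ (x, a') =
        2 * ζ * g ^ 2 * ∑ r : ι, (LatticeSineGordon.pairing (α r) φ x) ^ 2 := fun x =>
      quadForm_rankSum α (fun a => φ (x, a)) (2 * ζ * g ^ 2)
    simp_rw [hx]
    rw [Finset.mul_sum, Finset.mul_sum]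
    exact sum_congr rfl fun x _ => by ring
  rw [hmass, inv_mul_cancel_left₀ (pow_ne_zero 2 hg)]
  ring

/-- **Size of the remainder vertex**: `0 ≤ 2ζ Σ_x Σ_r [cos − 1 + u²/2](α_r·φ_x) ≤ (ζ/12) Σ_x Σ_r (α_r·φ_x)⁴`
for `ζ ≥ 0` — the perturbation of the Debye–Hückel Gaussian is a positive factor `≥ 1`, quartically
small in the field. [folklore] -/
theorem dh_remainder_bounds :
    ∀ (d N k : ℕ) [NeZero N] (ι : Type) [Fintype ι] (α : ι → Fin k → ℝ) (ζ : ℝ), 0 ≤ ζ → ∀ φ : LatticeSineGordon.Config d N k, 0 ≤ 2 * ζ * ∑ x : TorusSite d N, ∑ r : ι, (Real.cos (LatticeSineGordon.pairing (α r) φ x) - 1 + (LatticeSineGordon.pairing (α r) φ x) ^ 2 / 2) ∧ 2 * ζ * ∑ x : TorusSite d N, ∑ r : ι, (Real.cos (LatticeSineGordon.pairing (α r) φ x) - 1 + (LatticeSineGordon.pairing (α r) φ x) ^ 2 / 2) ≤ ζ / 12 * ∑ x : TorusSite d N, ∑ r : ι, (LatticeSineGordon.pairing (α r) φ x) ^ 4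 := by
  intro d N k _ ι _ α ζ hζ φ
  constructor
  · exact mul_nonneg (by positivity) (sum_nonneg fun x _ => sum_nonneg fun r _ => cos_sub_quadratic_nonneg _)
  · have h : ∑ x : TorusSite d N, ∑ r : ι, (Real.cos (LatticeSineGordon.pairing (α r) φ x) - 1 +
        (LatticeSineGordon.pairing (α r) φ x) ^ 2 / 2) ≤
        ∑ x : TorusSite d N, ∑ r : ι, (LatticeSineGordon.pairing (α r) φ x) ^ 4 / 24 :=
      sum_le_sum fun x _ => sum_le_sum fun r _ => cos_sub_quadratic_le _
    have h2 : ∑ x : TorusSite d N, ∑ r : ι, (LatticeSineGordon.pairing (α r) φ x) ^ 4 / 24 =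
        (∑ x : TorusSite d N, ∑ r : ι, (LatticeSineGordon.pairing (α r) φ x) ^ 4) / 24 := by
      rw [sum_div]
      exact sum_congr rfl fun x _ => by rw [sum_div]
    rw [h2] at h
    nlinarith

end Summit.QuantumFields.YangMills.Theorems.AnchorGap

end
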